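import Mathlib
import Literature.MathematicalPhysics.QuantumFieldTheory.Balaban1983to89.B12Decay510Window
import Literature.MathematicalPhysics.QuantumFieldTheory.Balaban1983to89.B12Ineq45

/-!
# `Balaban1983to89.B12Decay510FromB11` — T. Bałaban, *Renormalization group approach to lattice gauge field theories.
I. Generation of effective actions in a small field approximation and a coupling constant renormalization in four
dimensions*, Commun. Math. Phys. **109**, 249–301 (1987) [Balaban1987RG1], p. 282 [PDF 34] (the B₃-sentence) read
through [15] = T. Bałaban, *The variational problem and background fields in renormalization group method for lattice
gauge theories*, Commun. Math. Phys. **102**, 277–309 (1985) [Balaban1985Variational], Sect. G (190) p. 308 [PDF 32],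
and [3] = T. Bałaban, *Propagators and renormalization transformations for lattice gauge theories. II*, Commun. Math.
Phys. **96**, 223–250 (1984) [Balaban1984PropagatorsII], Lemma 2.1 (2.61) p. 234 [PDF 12]: **the leaf `hh` of
`B12Decay510` (decay of the restricted linearized minimizer) DISCHARGED from the tree's typed (190)**.

CITATION HEADER (lean-in-tree rule 2026-08-18).  Satellite of `…Balaban1983to89.B12Decay510` (the derivation of (5.10)
p. 293 modulo named printed leaves; unit `b2b-balaban-b03-g3`, cell GAPS C-b03g3-1 / G-b03g3-1), of
`…Balaban1983to89.B12Decay510Window` (its geometric leaves discharged on ℤᵈ-windows) and of `…Balaban1983to89.B12Ineq45`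
(unit pv12: (4.5) kernel-checked from (4.3)/(4.4)/(1.18), and the `n(p) = 1` input of p. 282 from [15] (190),
`B12Ineq45.loc_dH_le_of_ineq190_localised`).  Unit `b2b-balaban-b03-g4` (paper sub-cell B03 gen 4), answering cell GAPS
G-b03g3-1 (2)(a): *"p. 282 «can be estimated by B₃Π∣B_i∣ … additional exponential factor exp(−δ₀dist^{(ξ)}(X, supp B_i))»
for the n(p) = 1 block = decay of the restricted linearized minimizer δ𝐇_j/δB — BY REFERENCE to «Sect. G [15]», no
statement number … typed here as `hh`"*.  Quotations re-read on the 300-dpi renders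
`HOME/b2b-balaban-ref1/pages/1987-cmp109-rg-I-small-field/…-p033-x2.png` (p. 281), `…-p034-x2.png` (p. 282) and
`HOME/b2b-balaban-ref1/pages/1985-cmp102-variational-background/…-p032-x2.png` ((190) p. 308); (2.61) as typed in the
tree (`B6.Lemma21Printed`, `B11SectG.RowSum`).

WHAT THE PAPERS PRINT (and nothing else is attributed to them):
* B12 p. 282 [34], verbatim: *"The norm in (4.4) of the expression ⟨(δ^{n(p)}/δB^{n(p)})𝐇_j(□₀, 0), ⊗_{i∈N(p)}B_i⟩ can
  be estimated by B₃Π_{i∈N(p)}∣B_i∣, and if one of the functions B_i is localized outside the domain X, then we have the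
  additional exponential factor exp(−δ₀dist^{(ξ)}(X, supp B_i))."* — for the block `N(p) = {i}` (n(p) = 1) the
  expression is (δ/δB)𝐇_j(□₀, 0)B_i, the first B-derivative at B = 0 of the minimizer 𝐇_j(□₀, B) of (4.2) p. 281;
  B₃ and this δ₀ are NOT defined in B12 — the paragraph opens (p. 282, verbatim): *"The functional derivative
  (δ^{n(p)})/(δB^{n(p)})𝐇_j(□₀, 0) is given by a sum of several perturbative expressions discussed in Sect. G [15]. Each
  expression corresponds to a tree graph with n(p) initial points and one final point, and it has an exponential decay
  in a length of this graph. The derivative has an exponential decay in a length of a shortest tree graph of this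
  type."*, i.e. the bound is BY REFERENCE to [15] Sect. G, no statement number (cell GAPS G-b03g3-1 (2)(a)).
* B12 p. 281 [33] (4.4), verbatim: *"Thus it is defined and analytic on the space of configurations 𝐀 satisfying
  max{∣𝐀∣_X, ∣P₁(□₀)𝐀∣_X, ∣∇^ξ𝐀∣_X, ∣Δ^ξ𝐀∣_X} < α₂. (4.4)"* — the "norm in (4.4)" is this maximum of sup-norms OVER X of
  local quantities of the configuration.
* [15] p. 308 [32] (190), verbatim: *"This inequality, the formula (188) and Lemma 2.1, and finally Proposition 2 and
  (181), yield ∣(δ/δB_ν(y′))𝓗_μ(B,x)∣, ∣∇_x(δ/δB_ν(y′))𝓗_μ(B,x)∣, ‖ζ∇(δ/δB(y′))𝓗(B)‖_β, ∣D^{η*}_{U_k}D^η_{U_k}(δ/δB_ν(y))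
  𝓗_μ(B,x)∣, ∣Δ^η_{U_k}(δ/δB_ν(y′))𝓗_μ(B,x)∣ ≤ O(1)[(L^jη)^{−1}, (L^jη)^{−2}, (‖ζ‖^#_β + ∣ζ∣)(L^jη)^{−2−β}, (L^jη)^{−3},
  (L^jη)^{−3}]·(L^{j′}η)^{−d} exp(−⅛δ₀d(y,y′)) (190) for x ∈ Δ(y), or supp ζ ⊂ Δ̃(y), y ∈ Λ_j, y′ ∈ Λ_{j′}."* — in the
  tree the NAMED HYPOTHESIS `B11SectG.Ineq190 bB bout dH C δ₀` = *"δ𝓗 has the majorant C·e^{−⅛δ₀d(y,y′)} from the B-size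
  `bB` into the local size `bout`"* (one entry of (190) per local size; the scale weights inside the sizes), with
  `B11SectG.ineq190_of_189` deriving it from (189) and the printed leaves (cell GAPS C-B11-G2aK).
* [3] p. 234 [12] Lemma 2.1 (2.61), verbatim: *"sup_{y∈𝔅} Σ_{y′∈𝔅} e^{−αδ₀d(y,y′)} ≤ c₁(α), (2.61)"* — in the tree the
  hypothesis `B11SectG.RowSum g σ c` (= `B6RandomWalk.Ineq261` at σ = αδ₀, c = c₁(α), `B11SectG.rowSum_iff_ineq261`).

WHAT THIS MODULE PROVES (kernel-checked; every input a NAMED hypothesis, nothing asserted).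
(1) `norm_dH_le` — THE DICTIONARY.  On one system of localization domains with a site geometry
    (`B12Decay510.SiteGeometry`: dist(x, X)) and the block-majorant vocabulary of [15]/[3] (`B11SectG.BlockNorm` over the
    multiscale set 𝔅 = `g.Site` of a `B6.Geometry`): IF (190) holds for every local size `bout i` entering the
    (4.4)-functional (`h190`, constant C, rate ⅛δ₀^{[15]}), the row sum (2.61) holds at a rate σ (`hrow`), the
    (4.4)-functional of the domain X is DOMINATED by the local sizes over the blocks `blk X` of 𝔅 meeting X
    (`NormDominated` — the reading of *"∣·∣_X"* = sup over X), the unit source fields u(x) = δ_{(x,μ)} have B-size ≤ m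
    (`hm`) and are LOCALISED: their B-size vanishes on every block y′ of 𝔅 at multiscale distance < θ·dist(x, X) from a
    block meeting X (`UnitFieldsLocalised` — the reading of *"B_i is localized outside the domain X"* with
    *"dist^{(ξ)}(X, supp B_i)"* converted into the distance d(y, y′) of (190) by a factor θ), THEN
    ‖(δ𝐇_j(□₀,0)/δB)u(x)‖_X ≤ B₃ e^{−δ₀^{[I]} dist(x,X)} with B₃ = C·κ_B·c·m and δ₀^{[I]} = τθ for every τ ≥ 0 with
    σ + τ ≤ ⅛δ₀^{[15]} — pv12's `loc_dH_le_of_ineq190_localised` block by block, then the domination.  So the p. 282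
    constant "δ₀" of B12 is at most (⅛δ₀^{[15]} − σ)θ (cell GAPS G-IF-06 made explicit, as in `B12Ineq45`).
(2) `kernelBound_of_ineq190`, `abs_twoPoint_le_of_ineq190` — the leaf `hh` of `B12Decay510.kernelBound_of_repr435` /
    `abs_twoPoint_le_of_repr435` REPLACED by the inputs of (1): the two-sided kernel bound and the one-system (5.10)
    bound with C_E = A(Cκ_Bcm)² and δ₁ = ½ min{τθ, κM⁻¹}.
(3) `abs_twoPoint_le_of_analytic_190`, `decay510_of_analytic_leaves_190` — the same for the F-level statements of
    `B12Decay510` (Cauchy leaf kernel-derived from analyticity on (4.4) and (1.18)): the end-to-end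
    `B12Sec2to5.Decay510 P (4E₀α₂⁻²(Cκ_Bcm)² e^{δ₁Mc₁} K₀K₁) δ₁` from a volume-uniform family, with `hh` no longer a
    hypothesis — its place taken by (190), (2.61), the domination and the localisation of the unit fields, all with
    volume-uniform constants (C, δ₀^{[15]}, σ, c, κ_B ≤ κ̄_B, m, θ).
(4) `decay510_window_190` — the window form (`B12Decay510Window.decay510_window`: geometry, cube-sum and domain-sum
    leaves discharged on exhausting windows of ℤᵈ) with `hh` discharged likewise.
(5) `supLoc`, `normDominated_of_le_supLoc` — the domination hypothesis is exactly "‖ι_X A‖ ≤ max_{i, y∈blk X} loc^i_y(A)":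
    any identification ι_X of the real configurations with the (4.4)-space whose norm is bounded by the maximum of the
    local sizes over the blocks meeting X satisfies `NormDominated` (so the hypothesis is the literal (4.4)-on-X reading,
    not an extra assumption on the minimizer).
RESIDUAL LEAVES (named hypotheses, located in print, not proved here): (190) itself (hypothesis `Ineq190`; derived in
the tree from (189) + printed leaves by `B11SectG.ineq190_of_189`, the words *"and finally Proposition 2 and (181)"* not
typed — cell GAPS G-B11-G2a), the row sum (2.61) (hypothesis `RowSum`; [3] Lemma 2.1), and the three dictionary
hypotheses of (1) (domination, size and localisation of the unit fields) which identify B12's abstract carriers with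
[15]'s; plus every residual leaf of `B12Decay510` other than `hh`.
DIVERGENCES (cell DIVERGENCE.md D-b03.12): (i) B12 prints ONE constant δ₀ on p. 282 and in (5.10); the kernel rate is
τθ with τ ≤ ⅛δ₀^{[15]} − σ (σ > 0 the row-sum margin) and θ the unprinted conversion factor between dist^{(ξ)} of p. 282
and d(y, y′) of [3] (2.46) — B12's δ₀ is a generic constant, so this is a reading, recorded not resolved; (ii) the
(4.4)-functional restricted to X is modelled by the domination hypothesis over abstract blocks `blk X ⊂ 𝔅` (print: sup
over x ∈ X of local quantities; (190) is stated *"for x ∈ Δ(y)"*, so the sup over X is the max over the blocks Δ(y)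
meeting X); (iii) the higher blocks n(p) ≥ 2 of the p. 282 sentence are not touched (tree graphs of [15] Sect. G, cell
GAPS G-B11-G2a; they do not enter (4.35)).  Value = kernel-checked discharge of a located named leaf from the typed
published inequality it cites, NOT summit progress.
-/

namespace Literature.MathematicalPhysics.QuantumFieldTheory.Balaban1983to89.B12Decay510FromB11

open Literature.MathematicalPhysics.QuantumFieldTheory.Balaban1983to89
open Literature.MathematicalPhysics.QuantumFieldTheory.Balaban1983to89.B11SectG
open Literature.MathematicalPhysics.QuantumFieldTheory.Balaban1983to89.B12Decay510
open Filter Topology Metric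

/-! ## 1. The dictionary: the (4.4)-functional of a domain from the local sizes of (190) -/

section OneSystem

variable {g : B6.Geometry} {FB FA : Type} [AddCommGroup FB] [Module ℝ FB] [AddCommGroup FA] [Module ℝ FA]
variable {S : LocDomainSys} {C : B12.CubeCover S} {Λ : Type*} {I : Type*}

/-- **Domination of the (4.4)-functional of X by the local sizes** (B12 p. 281 [33] (4.4) *"max{∣𝐀∣_X, ∣P₁(□₀)𝐀∣_X,
∣∇^ξ𝐀∣_X, ∣Δ^ξ𝐀∣_X}"* — sup-norms over X of local quantities; [15] (190) p. 308 bounds exactly such local quantities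
*"for x ∈ Δ(y)"*, block by block): the identification `ι X` of a real configuration A with an element of the normed
(4.4)-space of the domain X has norm ≤ t as soon as every local size `(bout i).loc y A`, i ranging over the sizes
entering (4.4) and y over the blocks `blk X` of 𝔅 meeting X, is ≤ t (t ≥ 0).  A dictionary hypothesis (cell DIVERGENCE
D-b03.12 (ii)); `normDominated_of_le_supLoc` shows it is the literal "max over i and y ∈ blk X" reading.
[cite: Balaban1987RG1, (4.4) p.281; Balaban1985Variational, (190) p.308] -/
def NormDominated (bout : I → BlockNorm g FA) (blk : S.Dom → Finset g.Site) {V : S.Dom → Type*}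
    [∀ X, SeminormedAddCommGroup (V X)] (ι : (X : S.Dom) → FA → V X) : Prop :=
  ∀ (X : S.Dom) (A : FA) (t : ℝ), 0 ≤ t → (∀ i, ∀ y ∈ blk X, (bout i).loc y A ≤ t) → ‖ι X A‖ ≤ t

/-- **Localisation of the unit source fields** (B12 p. 282 [34] *"if one of the functions B_i is localized outside the
domain X, then we have the additional exponential factor exp(−δ₀dist^{(ξ)}(X, supp B_i))"*, read in the vocabulary of
[15] (190) whose decay is in the multiscale distance d(y, y′) of [3] (2.46)): the B-size of the unit field u(x) (the
B_i = δ_{(x,μ)} of (4.35)/(5.1)) vanishes on every block y′ of 𝔅 with d(y, y′) < θ·dist(x, X) for some block y meeting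
X — θ ≥ 0 the (unprinted) conversion factor between dist^{(ξ)} and d.  A dictionary hypothesis (cell DIVERGENCE
D-b03.12 (i)). [cite: Balaban1987RG1, p.282; Balaban1984PropagatorsII, (2.46) p.229] -/
def UnitFieldsLocalised (bB : BlockNorm g FB) (G : SiteGeometry C Λ) (blk : S.Dom → Finset g.Site) (u : Λ → FB)
    (θ : ℝ) : Prop :=
  ∀ (X : S.Dom) (x : Λ), ∀ y ∈ blk X, ∀ y' : g.Site, bB.loc y' (u x) ≠ 0 → θ * G.distD x X ≤ g.dist y y'

/-- **(1) The p. 282 decay of the restricted linearized minimizer from (190)** — the leaf `hh` of `B12Decay510`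
DERIVED: under (190) for every local size entering (4.4) (constant C ≥ 0, rate ⅛δ₀^{[15]}), the row sum (2.61) at rate
σ with constant c ≥ 0, the domination of the (4.4)-functional of X by the local sizes over the blocks meeting X, unit
fields of B-size ≤ m (m ≥ 0) localised as in `UnitFieldsLocalised`, and any τ ≥ 0 with σ + τ ≤ ⅛δ₀^{[15]}:
‖ι_X((δ𝐇_j(□₀,0)/δB) u(x))‖ ≤ C κ_B c m · e^{−τθ·dist(x,X)} — i.e. *"can be estimated by B₃∣B_i∣ … with the additional
exponential factor"* with B₃ = Cκ_Bcm and B12's δ₀ = τθ.  Proof: pv12's `B12Ineq45.loc_dH_le_of_ineq190_localised`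
on each block meeting X, then the domination. [cite: Balaban1987RG1, p.282; Balaban1985Variational, (190) p.308;
Balaban1984PropagatorsII, Lemma 2.1 (2.61) p.234] -/
theorem norm_dH_le (bB : BlockNorm g FB) (bout : I → BlockNorm g FA) (dH : FB →ₗ[ℝ] FA)
    {Cst δ₀ σ τ c m θ : ℝ} (h190 : ∀ i, Ineq190 bB (bout i) dH Cst δ₀) (hC : 0 ≤ Cst)
    (hd : ∀ a b : g.Site, 0 ≤ g.dist a b) (hrow : RowSum g σ c) (hc : 0 ≤ c) (hτ : 0 ≤ τ)
    (hστ : σ + τ ≤ δ₀ / 8) (G : SiteGeometry C Λ) (blk : S.Dom → Finset g.Site) {V : S.Dom → Type*}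
    [∀ X, SeminormedAddCommGroup (V X)] {ι : (X : S.Dom) → FA → V X} (hN : NormDominated bout blk ι)
    {u : Λ → FB} (hm₀ : 0 ≤ m) (hm : ∀ x y', bB.loc y' (u x) ≤ m) (hD : UnitFieldsLocalised bB G blk u θ)
    (X : S.Dom) (x : Λ) :
    ‖ι X (dH (u x))‖ ≤ Cst * bB.κ * c * m * Real.exp (-(τ * θ) * G.distD x X) := by
  have h0 : 0 ≤ Cst * bB.κ * c * m * Real.exp (-(τ * θ) * G.distD x X) :=
    mul_nonneg (mul_nonneg (mul_nonneg (mul_nonneg hC bB.κ_nonneg) hc) hm₀) (Real.exp_nonneg _)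
  refine hN X (dH (u x)) _ h0 fun i y hy => ?_
  have key := B12Ineq45.loc_dH_le_of_ineq190_localised (h190 i) hC hd hrow hτ hστ (u x) (hm x)
    (↑(blk X) : Set g.Site) (fun y₁ hy₁ y' hne => hD X x y₁ (Finset.mem_coe.mp hy₁) y' hne)
    (Finset.mem_coe.mpr hy)
  have e : -(τ * θ) * G.distD x X = -(τ * (θ * G.distD x X)) := by ring
  rw [e]
  exact key

/-- The constant B₃ = C κ_B c m of (1) is non-negative. [folklore] -/
theorem B₃_nonneg (bB : BlockNorm g FB) {Cst c m : ℝ} (hC : 0 ≤ Cst) (hc : 0 ≤ c) (hm₀ : 0 ≤ m) :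
    0 ≤ Cst * bB.κ * c * m :=
  mul_nonneg (mul_nonneg (mul_nonneg hC bB.κ_nonneg) hc) hm₀

/-! ## 2. The leaf `hh` of `B12Decay510` (B) replaced by (190) + (2.61) + the dictionary -/

/-- **(2) The two-sided kernel bound of (4.37)'s terms from (4.35) + (190)**: with the kernel represented as
𝐄^{(2)}(X, x, y) = Q_X(ι_X δ𝐇u(x), ι_X δ𝐇u(y)) ((4.35) p. 290, `hrepr`), the Cauchy bound ∣Q_X(a, b)∣ ≤ A e^{−κd_j(X)}‖a‖‖b‖
((4.3)–(4.5), `hQ`) and the inputs of `norm_dH_le` in place of the p. 282 decay: `KernelBound` with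
C_E = A·(Cκ_Bcm)² at the rates κ, τθ. [cite: Balaban1987RG1, (4.35) p.290 and p.282; Balaban1985Variational, (190) p.308] -/
theorem kernelBound_of_ineq190 (bB : BlockNorm g FB) (bout : I → BlockNorm g FA) (dH : FB →ₗ[ℝ] FA)
    {Cst δ₀ σ τ c m θ : ℝ} (h190 : ∀ i, Ineq190 bB (bout i) dH Cst δ₀) (hC : 0 ≤ Cst)
    (hd : ∀ a b : g.Site, 0 ≤ g.dist a b) (hrow : RowSum g σ c) (hc : 0 ≤ c) (hτ : 0 ≤ τ)
    (hστ : σ + τ ≤ δ₀ / 8) (G : SiteGeometry C Λ) (blk : S.Dom → Finset g.Site) {V : S.Dom → Type*}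
    [∀ X, SeminormedAddCommGroup (V X)] {ι : (X : S.Dom) → FA → V X} (hN : NormDominated bout blk ι)
    {u : Λ → FB} (hm₀ : 0 ≤ m) (hm : ∀ x y', bB.loc y' (u x) ≤ m) (hD : UnitFieldsLocalised bB G blk u θ)
    (Q : (X : S.Dom) → V X → V X → ℝ) (E2 : S.Dom → Λ → Λ → ℝ) {A κ : ℝ} (hA : 0 ≤ A)
    (hrepr : ∀ X x y, E2 X x y = Q X (ι X (dH (u x))) (ι X (dH (u y))))
    (hQ : ∀ X a b, |Q X a b| ≤ A * Real.exp (-κ * S.dj X) * ‖a‖ * ‖b‖) :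
    KernelBound G E2 (A * (Cst * bB.κ * c * m) ^ 2) κ (τ * θ) :=
  kernelBound_of_repr435 G Q (fun X x => ι X (dH (u x))) E2 hA (B₃_nonneg bB hC hc hm₀) hrepr hQ
    (norm_dH_le bB bout dH h190 hC hd hrow hc hτ hστ G blk hN hm₀ hm hD)

/-- **(2′) (5.10) on one finite system, B-level, with `hh` discharged**: (4.35) + the Cauchy bound `hQ` + (190) +
(2.61) + the dictionary + the geometry, cube-sum (at rate τθ/2) and domain-sum (at rate κ/2) leaves ⇒
∣Σ_X 𝐄^{(2)}(X, x, y)∣ ≤ A(Cκ_Bcm)² e^{δ₁Mc₁} K₀K₁ e^{−δ₁∣x − y∣}, δ₁ = ½ min{τθ, κM⁻¹}. [cite: Balaban1987RG1, (5.10) p.293] -/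
theorem abs_twoPoint_le_of_ineq190 (bB : BlockNorm g FB) (bout : I → BlockNorm g FA) (dH : FB →ₗ[ℝ] FA)
    {Cst δ₀ σ τ c m θ : ℝ} (h190 : ∀ i, Ineq190 bB (bout i) dH Cst δ₀) (hC : 0 ≤ Cst)
    (hd : ∀ a b : g.Site, 0 ≤ g.dist a b) (hrow : RowSum g σ c) (hc : 0 ≤ c) (hτ : 0 ≤ τ) (hθ : 0 ≤ θ)
    (hστ : σ + τ ≤ δ₀ / 8) (G : SiteGeometry C Λ) (blk : S.Dom → Finset g.Site) {V : S.Dom → Type*}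
    [∀ X, SeminormedAddCommGroup (V X)] {ι : (X : S.Dom) → FA → V X} (hN : NormDominated bout blk ι)
    {u : Λ → FB} (hm₀ : 0 ≤ m) (hm : ∀ x y', bB.loc y' (u x) ≤ m) (hD : UnitFieldsLocalised bB G blk u θ)
    {ρ : Λ → Λ → ℝ} (Q : (X : S.Dom) → V X → V X → ℝ) (E2 : S.Dom → Λ → Λ → ℝ) {A κ M c₁ K₀ K₁ : ℝ}
    (hA : 0 ≤ A) (hK₀ : 0 ≤ K₀) (hκ : 0 ≤ κ) (hM : 0 < M)
    (hrepr : ∀ X x y, E2 X x y = Q X (ι X (dH (u x))) (ι X (dH (u y))))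
    (hQ : ∀ X a b, |Q X a b| ≤ A * Real.exp (-κ * S.dj X) * ‖a‖ * ‖b‖)
    (hgeo : GeomLeaf G ρ M c₁) (hcube : CubeSumLeaf G (τ * θ / 2) K₁) (htree : TreeLeaf C (κ / 2) K₀)
    (x y : Λ) :
    |∑ X, E2 X x y| ≤ A * (Cst * bB.κ * c * m) ^ 2 * Real.exp (delta1 (τ * θ) κ M * M * c₁) * K₀ * K₁ *
      Real.exp (-(delta1 (τ * θ) κ M) * ρ x y) :=
  abs_twoPoint_le_of_repr435 G Q (fun X x => ι X (dH (u x))) E2 hA (B₃_nonneg bB hC hc hm₀) hK₀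
    (mul_nonneg hτ hθ) hκ hM hrepr hQ (norm_dH_le bB bout dH h190 hC hd hrow hc hτ hστ G blk hN hm₀ hm hD)
    hgeo hcube htree x y

/-! ## 3. The F-level statements of `B12Decay510` with `hh` discharged -/

variable {W : Type*} [NormedAddCommGroup W] [NormedSpace ℂ W]

/-- **(3) (5.10) on one finite system, Cauchy leaf kernel-derived, `hh` discharged**: 𝐀 ↦ 𝐄^{(j)}(X, exp iξ𝐀) analytic
on the (4.4)-ball of radius α₂ of the complex configuration space W and bounded there by E₀e^{−κd_j(X)} ((1.18)), the
kernel = Re ∂²/∂τ₁∂τ₂ on the pair (ι_X δ𝐇u(x), ι_X δ𝐇u(y)) ((4.3) at r = 2 / (4.35)), ι_X : real configurations → W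
dominated by the local sizes over the blocks meeting X, (190), (2.61), unit fields of size ≤ m localised, and the three
geometric leaves ⇒ ∣Σ_X 𝐄^{(2)}(X, x, y)∣ ≤ 4E₀α₂⁻²(Cκ_Bcm)² e^{δ₁Mc₁} K₀K₁ e^{−δ₁∣x − y∣}, δ₁ = ½ min{τθ, κM⁻¹}.
[cite: Balaban1987RG1, (5.10) p.293; Balaban1985Variational, (190) p.308] -/
theorem abs_twoPoint_le_of_analytic_190 (bB : BlockNorm g FB) (bout : I → BlockNorm g FA) (dH : FB →ₗ[ℝ] FA)
    {Cst δ₀ σ τ c m θ : ℝ} (h190 : ∀ i, Ineq190 bB (bout i) dH Cst δ₀) (hC : 0 ≤ Cst)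
    (hd : ∀ a b : g.Site, 0 ≤ g.dist a b) (hrow : RowSum g σ c) (hc : 0 ≤ c) (hτ : 0 ≤ τ) (hθ : 0 ≤ θ)
    (hστ : σ + τ ≤ δ₀ / 8) (G : SiteGeometry C Λ) (blk : S.Dom → Finset g.Site) {ι : S.Dom → FA → W}
    (hN : NormDominated bout blk (V := fun _ => W) ι) {u : Λ → FB} (hm₀ : 0 ≤ m)
    (hm : ∀ x y', bB.loc y' (u x) ≤ m) (hD : UnitFieldsLocalised bB G blk u θ) {ρ : Λ → Λ → ℝ}
    (EX : S.Dom → W → ℂ) (E2 : S.Dom → Λ → Λ → ℝ) {α₂ E₀ κ M c₁ K₀ K₁ : ℝ} (hα₂ : 0 < α₂) (hE₀ : 0 ≤ E₀)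
    (hK₀ : 0 ≤ K₀) (hκ : 0 ≤ κ) (hM : 0 < M) (han : ∀ X, AnalyticOnNhd ℂ (EX X) (ball 0 α₂))
    (h118 : ∀ X, ∀ v ∈ ball (0 : W) α₂, ‖EX X v‖ ≤ E₀ * Real.exp (-κ * S.dj X))
    (hrepr : ∀ X x y, E2 X x y = (mixedDeriv (EX X) (ι X (dH (u x))) (ι X (dH (u y)))).re)
    (hgeo : GeomLeaf G ρ M c₁) (hcube : CubeSumLeaf G (τ * θ / 2) K₁) (htree : TreeLeaf C (κ / 2) K₀)
    (x y : Λ) :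
    |∑ X, E2 X x y| ≤ 4 * E₀ / α₂ ^ 2 * (Cst * bB.κ * c * m) ^ 2 *
      Real.exp (delta1 (τ * θ) κ M * M * c₁) * K₀ * K₁ * Real.exp (-(delta1 (τ * θ) κ M) * ρ x y) :=
  abs_twoPoint_le_of_analytic G EX (fun X x => ι X (dH (u x))) E2 hα₂ hE₀ (B₃_nonneg bB hC hc hm₀) hK₀
    (mul_nonneg hτ hθ) hκ hM han h118 hrepr
    (norm_dH_le bB bout dH h190 hC hd hrow hc hτ hστ G blk (V := fun _ => W) hN hm₀ hm hD) hgeo hcube htree x y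

end OneSystem

/-! ## 4. The end-to-end statements: `B12Sec2to5.Decay510` with `hh` discharged -/

section Family

variable {I : Type*}

/-- **(3′) The whole chain for the tree hypothesis `Decay510`, leaf `hh` discharged** (census row G-B12s-15; cell GAPS
G-b03g3-1 (2)(a) answered): a family of finite systems (tori of (5.1)) carrying, each, the B12-side data of
`B12Decay510.decay510_of_analytic_leaves` EXCEPT the decay `hh`, and instead the [15]/[3]-side data — a multiscale
geometry 𝔅_n, B-sizes with cutting costs κ_B ≤ κ̄_B, the local sizes of (4.4), the first B-derivative δ𝐇 of the
minimizer with (190) (constant C, rate ⅛δ₀^{[15]}), the row sum (2.61) (rate σ, constant c), identifications ι of the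
real configurations with the complex (4.4)-spaces dominated by the local sizes over the blocks meeting each domain, and
unit source fields of B-size ≤ m localised with conversion factor θ — all constants uniform in n — ⇒
`B12Sec2to5.Decay510 P (4E₀α₂⁻²(Cκ̄_Bcm)² e^{δ₁Mc₁} K₀K₁) δ₁` with δ₁ = ½ min{τθ, κM⁻¹}, for every τ ≥ 0 with
σ + τ ≤ ⅛δ₀^{[15]}. [cite: Balaban1987RG1, (5.10) p.293; Balaban1985Variational, (190) p.308;
Balaban1984PropagatorsII, Lemma 2.1 (2.61) p.234] -/
theorem decay510_of_analytic_leaves_190 {d : ℕ} (Sn : ℕ → LocDomainSys) (Cn : (n : ℕ) → B12.CubeCover (Sn n))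
    (Λn : ℕ → Type*) (Gn : (n : ℕ) → SiteGeometry (Cn n) (Λn n)) (ρn : (n : ℕ) → Λn n → Λn n → ℝ)
    (Wn : ℕ → Type*) [∀ n, NormedAddCommGroup (Wn n)] [∀ n, NormedSpace ℂ (Wn n)]
    (EXn : (n : ℕ) → (Sn n).Dom → Wn n → ℂ) (E2n : (n : ℕ) → (Sn n).Dom → Λn n → Λn n → ℝ)
    (e : (n : ℕ) → (Fin d → ℤ) → Λn n) (P : (Fin d → ℤ) → ℝ)
    (gn : ℕ → B6.Geometry) (FBn FAn : ℕ → Type) [∀ n, AddCommGroup (FBn n)] [∀ n, Module ℝ (FBn n)]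
    [∀ n, AddCommGroup (FAn n)] [∀ n, Module ℝ (FAn n)] (bBn : (n : ℕ) → BlockNorm (gn n) (FBn n))
    (boutn : (n : ℕ) → I → BlockNorm (gn n) (FAn n)) (dHn : (n : ℕ) → FBn n →ₗ[ℝ] FAn n)
    (blkn : (n : ℕ) → (Sn n).Dom → Finset (gn n).Site) (ιn : (n : ℕ) → (Sn n).Dom → FAn n → Wn n)
    (un : (n : ℕ) → Λn n → FBn n) {Cst δ₀ σ τ c m θ κB α₂ E₀ κ M c₁ K₀ K₁ : ℝ}
    (h190 : ∀ n i, Ineq190 (bBn n) (boutn n i) (dHn n) Cst δ₀) (hC : 0 ≤ Cst)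
    (hd : ∀ n (a b : (gn n).Site), 0 ≤ (gn n).dist a b) (hrow : ∀ n, RowSum (gn n) σ c) (hc : 0 ≤ c)
    (hτ : 0 ≤ τ) (hθ : 0 ≤ θ) (hστ : σ + τ ≤ δ₀ / 8) (hκB : ∀ n, (bBn n).κ ≤ κB)
    (hN : ∀ n, NormDominated (boutn n) (blkn n) (V := fun _ => Wn n) (ιn n)) (hm₀ : 0 ≤ m)
    (hm : ∀ n x y', (bBn n).loc y' (un n x) ≤ m) (hD : ∀ n, UnitFieldsLocalised (bBn n) (Gn n) (blkn n) (un n) θ)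
    (hα₂ : 0 < α₂) (hE₀ : 0 ≤ E₀) (hK₀ : 0 ≤ K₀) (hκ : 0 ≤ κ) (hM : 0 < M)
    (han : ∀ n X, AnalyticOnNhd ℂ (EXn n X) (ball 0 α₂))
    (h118 : ∀ n X, ∀ v ∈ ball (0 : Wn n) α₂, ‖EXn n X v‖ ≤ E₀ * Real.exp (-κ * (Sn n).dj X))
    (hrepr : ∀ n X x y, E2n n X x y =
      (mixedDeriv (EXn n X) (ιn n X (dHn n (un n x))) (ιn n X (dHn n (un n y)))).re)
    (hgeo : ∀ n, GeomLeaf (Gn n) (ρn n) M c₁) (hcube : ∀ n, CubeSumLeaf (Gn n) (τ * θ / 2) K₁)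
    (htree : ∀ n, TreeLeaf (Cn n) (κ / 2) K₀)
    (hρ : ∀ z, ∀ᶠ n in atTop, ρn n (e n 0) (e n z) = B12Sec2to5.l1 z)
    (hlim : ∀ z, Tendsto (fun n => ∑ X, E2n n X (e n 0) (e n z)) atTop (𝓝 (P z))) :
    B12Sec2to5.Decay510 P (4 * E₀ / α₂ ^ 2 * (Cst * κB * c * m) ^ 2 *
      Real.exp (delta1 (τ * θ) κ M * M * c₁) * K₀ * K₁) (delta1 (τ * θ) κ M) := by
  have hκB0 : 0 ≤ κB := (bBn 0).κ_nonneg.trans (hκB 0)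
  refine decay510_of_analytic_leaves Sn Cn Λn Gn ρn Wn EXn (fun n X x => ιn n X (dHn n (un n x))) E2n e P
    hα₂ hE₀ (mul_nonneg (mul_nonneg (mul_nonneg hC hκB0) hc) hm₀) hK₀ (mul_nonneg hτ hθ) hκ hM han h118 hrepr
    (fun n X x => ?_) hgeo hcube htree hρ hlim
  have h1 := norm_dH_le (bBn n) (boutn n) (dHn n) (h190 n) hC (hd n) (hrow n) hc hτ hστ (Gn n) (blkn n)
    (V := fun _ => Wn n) (hN n) hm₀ (hm n) (hD n) X x
  have h2 : Cst * (bBn n).κ * c * m ≤ Cst * κB * c * m :=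
    mul_le_mul_of_nonneg_right (mul_le_mul_of_nonneg_right (mul_le_mul_of_nonneg_left (hκB n) hC) hc) hm₀
  exact h1.trans (mul_le_mul_of_nonneg_right h2 (Real.exp_nonneg _))

end Family

/-! ## 5. The window form (`B12Decay510Window`) with `hh` discharged -/

section Window

open Literature.MathematicalPhysics.QuantumFieldTheory.Balaban1983to89.B13ScaleTransfer (Pt)
open Literature.MathematicalPhysics.QuantumFieldTheory.Balaban1983to89.TreeLength (treeLen)
open Literature.MathematicalPhysics.QuantumFieldTheory.Balaban1983to89.TreeLengthCubeSystem (Dom sys cubeSys)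
open Literature.MathematicalPhysics.QuantumFieldTheory.Balaban1983to89.B12TreeDecay (K₀ kappa₀)
open Literature.MathematicalPhysics.QuantumFieldTheory.Balaban1983to89.B12Decay510Window (geom nearest decay510_window)
open Literature.MathematicalPhysics.QuantumFieldTheory.Balaban1983to89.B12Sec2to5 (l1)

variable {I : Type*}

/-- **(4) (5.10) = `B12Sec2to5.Decay510` on exhausting windows of ℤᵈ, every geometric leaf AND `hh` discharged**: the
hypotheses of `B12Decay510Window.decay510_window` except `hh`, plus the [15]/[3]-side data of
`decay510_of_analytic_leaves_190` on each window (the site geometry being the window's: dist(x, X) = ∣x − nearest cube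
of X∣₁), τ > 0, θ > 0 ⇒ `Decay510 P (4E₀α₂⁻²(Cκ̄_Bcm)² e^{2dδ₁} K₀(4·2ᵈ, 2d) K₁(τθ/2)) δ₁`, δ₁ = ½ min{τθ, κ/d}.
[cite: Balaban1987RG1, (5.10) p.293; Balaban1985Variational, (190) p.308] -/
theorem decay510_window_190 {d : ℕ} (hd : 0 < d) (B : ℕ → Finset (Pt d)) (Wn : ℕ → Type*)
    [∀ n, NormedAddCommGroup (Wn n)] [∀ n, NormedSpace ℂ (Wn n)]
    (EXn : (n : ℕ) → Dom (B n) → Wn n → ℂ) (E2n : (n : ℕ) → Dom (B n) → Pt d → Pt d → ℝ) (P : Pt d → ℝ)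
    (gn : ℕ → B6.Geometry) (FBn FAn : ℕ → Type) [∀ n, AddCommGroup (FBn n)] [∀ n, Module ℝ (FBn n)]
    [∀ n, AddCommGroup (FAn n)] [∀ n, Module ℝ (FAn n)] (bBn : (n : ℕ) → BlockNorm (gn n) (FBn n))
    (boutn : (n : ℕ) → I → BlockNorm (gn n) (FAn n)) (dHn : (n : ℕ) → FBn n →ₗ[ℝ] FAn n)
    (blkn : (n : ℕ) → Dom (B n) → Finset (gn n).Site) (ιn : (n : ℕ) → Dom (B n) → FAn n → Wn n)
    (un : (n : ℕ) → Pt d → FBn n) {Cst δ₀ σ τ c m θ κB α₂ E₀ κ : ℝ}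
    (h190 : ∀ n i, Ineq190 (bBn n) (boutn n i) (dHn n) Cst δ₀) (hC : 0 ≤ Cst)
    (hdist : ∀ n (a b : (gn n).Site), 0 ≤ (gn n).dist a b) (hrow : ∀ n, RowSum (gn n) σ c) (hc : 0 ≤ c)
    (hτ : 0 < τ) (hθ : 0 < θ) (hστ : σ + τ ≤ δ₀ / 8) (hκB : ∀ n, (bBn n).κ ≤ κB)
    (hN : ∀ n, NormDominated (S := sys (B n)) (boutn n) (blkn n) (V := fun _ => Wn n) (ιn n)) (hm₀ : 0 ≤ m)
    (hm : ∀ n x y', (bBn n).loc y' (un n x) ≤ m)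
    (hD : ∀ n, UnitFieldsLocalised (bBn n) (geom (B n)) (blkn n) (un n) θ)
    (hα₂ : 0 < α₂) (hE₀ : 0 ≤ E₀) (hκ : kappa₀ (4 * 2 ^ d) (2 * d) ≤ κ / 2)
    (han : ∀ n X, AnalyticOnNhd ℂ (EXn n X) (ball 0 α₂))
    (h118 : ∀ n X, ∀ v ∈ ball (0 : Wn n) α₂, ‖EXn n X v‖ ≤ E₀ * Real.exp (-κ * treeLen X.1))
    (hrepr : ∀ n X x y, E2n n X x y =
      (mixedDeriv (EXn n X) (ιn n X (dHn n (un n x))) (ιn n X (dHn n (un n y)))).re)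
    (hlim : ∀ z, Tendsto (fun n => ∑ X : Dom (B n), E2n n X 0 z) atTop (𝓝 (P z))) :
    B12Sec2to5.Decay510 P (4 * E₀ / α₂ ^ 2 * (Cst * κB * c * m) ^ 2 * Real.exp (delta1 (τ * θ) κ d * d * 2) *
      K₀ (4 * 2 ^ d) (2 * d) * B12Decay510Window.K₁ d (τ * θ / 2)) (delta1 (τ * θ) κ d) := by
  have hκB0 : 0 ≤ κB := (bBn 0).κ_nonneg.trans (hκB 0)
  refine decay510_window hd B Wn EXn (fun n X x => ιn n X (dHn n (un n x))) E2n P hα₂ hE₀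
    (mul_nonneg (mul_nonneg (mul_nonneg hC hκB0) hc) hm₀) (mul_pos hτ hθ) hκ han h118 hrepr (fun n X x => ?_) hlim
  have h1 := norm_dH_le (bBn n) (boutn n) (dHn n) (h190 n) hC (hdist n) (hrow n) hc hτ.le hστ (geom (B n))
    (blkn n) (V := fun _ => Wn n) (hN n) hm₀ (hm n) (hD n) X x
  have h2 : Cst * (bBn n).κ * c * m ≤ Cst * κB * c * m :=
    mul_le_mul_of_nonneg_right (mul_le_mul_of_nonneg_right (mul_le_mul_of_nonneg_left (hκB n) hC) hc) hm₀
  simpa using h1.trans (mul_le_mul_of_nonneg_right h2 (Real.exp_nonneg _))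

end Window

/-! ## 6. The domination hypothesis is the literal "max over the blocks meeting X" reading -/

section SupLoc

variable {g : B6.Geometry} {FA : Type} [AddCommGroup FA] [Module ℝ FA] {I : Type*} [Fintype I]
variable {S : LocDomainSys}

/-- max_{i, y ∈ B} loc^i_y(A) — the maximum of the local sizes `bout i` of a configuration A over the sizes i and a
finite set B of blocks (0 if B is empty): the (4.4)-functional *"max{∣𝐀∣_X, ∣P₁(□₀)𝐀∣_X, ∣∇^ξ𝐀∣_X, ∣Δ^ξ𝐀∣_X}"* of
B12 p. 281 when B = the blocks meeting X and the `bout i` are the corresponding local sup-sizes.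
[cite: Balaban1987RG1, (4.4) p.281] -/
noncomputable def supLoc (bout : I → BlockNorm g FA) (B : Finset g.Site) (A : FA) : ℝ :=
  ((Finset.univ ×ˢ B).sup fun p : I × g.Site => ((bout p.1).loc p.2 A).toNNReal : NNReal)

/-- Each local size over a block of B is ≤ the maximum. [folklore] -/
theorem loc_le_supLoc (bout : I → BlockNorm g FA) (B : Finset g.Site) (A : FA) (i : I) {y : g.Site}
    (hy : y ∈ B) : (bout i).loc y A ≤ supLoc bout B A := by
  have h : ((bout i).loc y A).toNNReal ≤
      (Finset.univ ×ˢ B).sup fun p : I × g.Site => ((bout p.1).loc p.2 A).toNNReal :=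
    Finset.le_sup (f := fun p : I × g.Site => ((bout p.1).loc p.2 A).toNNReal)
      (Finset.mk_mem_product (Finset.mem_univ i) hy)
  have h' : (((bout i).loc y A).toNNReal : ℝ) ≤ supLoc bout B A := by exact_mod_cast h
  rwa [Real.coe_toNNReal _ ((bout i).loc_nonneg y A)] at h'

/-- The maximum is ≤ t as soon as every local size over B is (t ≥ 0). [folklore] -/
theorem supLoc_le (bout : I → BlockNorm g FA) (B : Finset g.Site) (A : FA) {t : ℝ} (ht : 0 ≤ t)
    (h : ∀ i, ∀ y ∈ B, (bout i).loc y A ≤ t) : supLoc bout B A ≤ t := by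
  have key : ((Finset.univ ×ˢ B).sup fun p : I × g.Site => ((bout p.1).loc p.2 A).toNNReal) ≤ t.toNNReal := by
    refine Finset.sup_le fun p hp => ?_
    have hp2 : p.2 ∈ B := (Finset.mem_product.mp hp).2
    exact Real.toNNReal_le_toNNReal (h p.1 p.2 hp2)
  have key' : (supLoc bout B A : ℝ) ≤ (t.toNNReal : ℝ) := by
    unfold supLoc
    exact_mod_cast key
  rwa [Real.coe_toNNReal _ ht] at key'

/-- **(5)** Any identification ι_X of the real configurations with the (4.4)-space of X whose norm is bounded by the
maximum of the local sizes over the blocks meeting X — ‖ι_X A‖ ≤ max_{i, y∈blk X} loc^i_y(A) — satisfies the domination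
hypothesis `NormDominated`. [cite: Balaban1987RG1, (4.4) p.281] -/
theorem normDominated_of_le_supLoc (bout : I → BlockNorm g FA) (blk : S.Dom → Finset g.Site)
    {V : S.Dom → Type*} [∀ X, SeminormedAddCommGroup (V X)] (ι : (X : S.Dom) → FA → V X)
    (hι : ∀ X A, ‖ι X A‖ ≤ supLoc bout (blk X) A) : NormDominated bout blk ι :=
  fun X A _t ht h => (hι X A).trans (supLoc_le bout (blk X) A ht h)

end SupLoc

end Literature.MathematicalPhysics.QuantumFieldTheory.Balaban1983to89.B12Decay510FromB11
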